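import Summits.BirchSwinnertonDyer.Rank1Residual.Additive.PotSupersingularClasses
import Summits.BirchSwinnertonDyer.Rank1Residual.Additive.WildThreeKrausCells
import Summits.BirchSwinnertonDyer.Rank1Residual.Additive.X4RankZeroKatoBound
import Summits.BirchSwinnertonDyer.Rank1Residual.AdditivePotMult.ModelFreeClassTheorems
import HarnessLib
import HarnessLib.Audit.Tags

/-!
# The open classes O5 / O6 of the residual map, part 2/2 — TARGETS, conjecture slots, the Kato reduction to the LOWER half, and the Milne twist TRANSPORT (cell `b2b-bsdres`, lane CLASS-CLOSURE, seat cc-typer-5)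

HONEST FRAMING (cell `b2b-bsdres`, run/shared/lean/b2b/bsd-rank1-residual/, verbatim in every
file): the goal of the cell is to DELETE the COMBINATION-SHAPED residual classes of the
Birch–Swinnerton-Dyer formula for ALL analytic-rank `≤ 1` elliptic curves over `ℚ` — "full BSD
formula for every rank `≤ 1` curve in class `C`" assembled STRICTLY from published theorems — so
that the rank-`≤ 1` remainder becomes exactly the CONSTRUCTION-SHAPED classes, which are TYPED
(missing-input `Prop`s), NOT attempted. This is not "finishing BSD". Lane CLASS-CLOSURE
(coordinator ruling 2026-08-21T04:07:19Z): research routes; no claim beyond the stated classes;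
census output is EVIDENCE, never a Literature fact; conjectures below are `def … : Prop` tagged
`@[conjecture]`, never asserted; no label of `RESIDUAL-MAP.md` moves and nothing is booked here.

Part 1 (`Additive/PotSupersingularClasses.lean`) typed the classes `ClassO5` (tame potentially
supersingular = `(G) ∧ ss` ∪ `(t′)`) and `ClassO6` (wild `p = 3`) and their sub-partition. Here:

§2 TARGETS and conjecture slots (deliverable (a) of the lane): `O5.Statement`, `O6.Statement`
(`∀` pairs of the class with `r_an ≤ 1`, `BSDp`; OPEN); `O5Sharp`/`O5SharpGss`/`O5SharpTprime`,
`O6Sharp` (the class-restricted `MissingPPartAt` conjectures, as `X3Sharp…`/`X4Sharp…` of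
`SharpenedStatements.lean`) with `o5Sharp_iff` and `o6Sharp_iff_cyclic_dicyclic` (O6♯ ⟺ its Kraus
cyclic ∧ dicyclic parts, `WildThreeKrausCells.lean`); and the ONE uniform rank-`0` lower-half conjecture
`PotGoodLowerHalfRankZero` ("`ord_p #Ш_an ≤ ord_p #Ш` at every odd potentially good additive prime
in analytic rank `0`"). Its Iwasawa-theoretic antecedent IS FORMULATED IN PRINT for every
`(f_E, p)`: K. Kato, Astérisque 295 (2004) **Conj. 12.10** (p. 224, "main conjecture": stated for
the prime `p` fixed in §12 with NO reduction hypothesis on `f`, over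
`Λ = O_λ[[Gal(ℚ(ζ_{p^∞})/ℚ)]]`, every height-one prime) and, at `T = 0`, the
Bloch–Kato/Fontaine–Perrin-Riou/Kato Tamagawa-number equality `#H²(ℤ[1/p], T) = [H¹(ℤ[1/p], T) : z]`
which Kato's text says is "predicted" in Thm. 14.5 (3) (p. 237) — the INEQUALITY `≤` being Kato's
Thm. 12.5 (4)/14.5 (3) under (12.5.2), i.e. the kernel's `X4RankZero.missingUpperBoundAt_of_kato`
(additive-p4 line V20). On `(G) ∧ ss` the same object has a SIGNED avatar in print: S. Kobayashi,
Invent. Math. 152 (2003) §4 p. 8, "Even main conjecture: for EVERY `η`,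
`Char X⁺(E/K_∞)^η = (L_p⁺(E, η, X))`" (odd, `η ≠ 1`: `Char X⁻(E/K_∞)^η = (X⁻¹L_p⁻(E, η, X))`),
Thm. 7.4 (equivalent to Kato's 12.10 branch by branch), Thm. 4.1 (the Kato inclusion, every `η`) —
applied to the good supersingular twist `V = E^{(p*)}` on the branch `η = ω^{(p−1)/2} = χ_{p*}`;
and D. Delbourgo, Compositio 113 (1998) Thm. 1 (p. 131) constructs under (G) — potentially ordinary
OR supersingular — a unique `1`-admissible measure `μ_E`, with the forecast p. 152 ("if `E` is
potentially supersingular at `p` then `X_∞` will have `Λ`-rank 1 … two `p`-adic `L`-functions … it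
should still be feasible to calculate their leading terms"; "if `E` doesn't satisfy (G) … the
method presented here cannot cope"). READING recorded here for the map owners to rule on (no mark
is moved by this file): on `O5 ∩ X4 ∩ r = 0 ∩ (12.5.2)` and `O6 ∩ X4 ∩ r = 0 ∩ (12.5.2)` the missing
statement is the LOWER half ONLY and it is IN PRINT AS A CONJECTURE (Kato 12.10 / [BK2]); the
words "nothing formulated" of RESIDUAL-MAP §I O5/O6 apply to the SIGNED (`±`/`♯♭`) objects at the
additive prime itself — which exist in print exactly on `(G) ∧ ss`, through the twist — and to
every rank-`1` pair (O7-ss).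

§3 What is PROVABLE NOW (bookkeeping against the kernel): on `ClassO5 ∪ ClassO6` ∩ `ClassX4` ∩
`r_an = 0` with tower surjectivity (`∀ n, ρ̄_{E,p^n}` onto = Kato's (12.5.2)), `p ∤ ∏ c_ℓ` and a
parametrisation datum with `p ∤ c_D`, the typed missing input IS EQUIVALENT TO ITS LOWER HALF
(`ClassO5.missingPPartAt_iff_lower_of_kato`, `ClassO6.…`, instances of additive-p4's
`X4RankZero.missingPPartAt_iff_lower_of_kato`, `0 ≤ ord_p j` being `¬PotMult`), and
`PotGoodLowerHalfRankZero` closes those rows (`bsdp_rankZero_of_potGoodLowerHalf_of_kato`) — the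
"verbatim-extension" shape handed to provers: ONE inequality at an additive prime.

§4 TRANSPORT (deliverable (c)). T-twist/base change — printed antecedent J. S. Milne, Invent. Math.
17 (1972) §1 Thm. 1 (BSD is compatible with Weil restriction, `Res_{K/ℚ} E_K ~ E × E^{(d_K)}`;
Cassels–Tate isogeny invariance inside): on `(G) ∧ ss` take `K = ℚ(√p*)`, `d_K = p*`, so that the
twist `Wd = E^{(d_K)} = V` is GOOD SUPERSINGULAR at `p`; the tree's model-free descent
(`AdditivePotMult.missingPPartOverCAt_baseChange_iff_bsdp`, any `p`) gives **`BSD_p(E) ⟺ [p-part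
of BSD for E_K ≅ V_K over K]` granted `BSD_p(V)`** — `SubGss.bsdp_iff_overC_of_bsdp_twist`, with
`V`'s own cell in the docstring — and the LOWER half alone transports likewise
(`SubGss.missingLowerBoundAt_iff_overC_of_bsdp_twist`). T-isogeny: BSD truth and every predicate of
part 1 are invariants of the `ℚ`-isogeny class under isogenies of degree prime to `p` (Cassels
1965 / Milne) — used only for class-vs-curve counting. T-congruence: Fouquet–Wan arXiv:2107.13726
(PRE) would transfer Kato's 12.10 along `p`-adic families from ANY classical point where it is
known; at a potentially supersingular `p` with `e ∤ p − 1` the local residual representation is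
irreducible and NO nearly-ordinary point exists (harvest-2 HARVEST §E19.4 (d2)) — no PUBLISHED
congruence transport applies; recorded, not typed.

References: K. Kato, Astérisque 295 (2004) Conj. 12.10 (p. 224), Thm. 12.5 (4) (p. 222), Thm. 14.5 (3)
and the remark after it (pp. 236–237) [Kato2004Asterisque]; S. Kobayashi, Invent. Math. 152 (2003)
§4 (p. 8), Thm. 4.1, Thm. 7.4 [Kobayashi2003]; D. Delbourgo, Compositio Math. 113 (1998) Thm. 1
(p. 131), §2.5, p. 152 [Delbourgo1998]; J. S. Milne, Invent. Math. 17 (1972) §1 Thm. 1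
[Milne1972ArithmeticAV]; J. W. S. Cassels, J. reine angew. Math. 217 (1965); O. Fouquet, X. Wan,
arXiv:2107.13726 (PRE); HOME/b2b-bsdres-harvest-2/HARVEST.md §E19.4; RESIDUAL-MAP.md §D/§I;
CLASS-CLOSURE-PLAN.md §3.4–§3.5; HOME/class-closure/O5/TYPED.md, O6/TYPED.md (this seat).
-/

noncomputable section

open scoped Classical NumberField

open WeierstrassCurve IsDedekindDomain NumberField Literature.NumberTheory.EllipticCurves
  Literature.NumberTheory.EllipticCurves.ModularForms
  Literature.NumberTheory.EllipticCurves.Rank1Residual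
  Literature.NumberTheory.EllipticCurves.Rank1Residual.Typed

namespace Summit.BirchSwinnertonDyer.Rank1Residual.Additive

/-! ## §2 Targets and conjecture slots (OPEN — `def`s, never asserted) -/

/-- **Target of class O5** (OPEN PROBLEM; mark OPEN on RESIDUAL-MAP §I; research route, no claim):
for every `E/ℚ` of analytic rank `≤ 1` and every prime `p` with `(E, p) ∈ O5`, Miller's `BSD(E,p)`.
Nothing in print implies it; recorded as a `Prop`. -/
@[conjecture] def O5.Statement : Prop :=
  ∀ (W : WeierstrassCurve ℚ) [W.IsElliptic] [W.IsGloballyMinimal] (p : ℕ) [Fact p.Prime],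
    W.analyticRank ≤ 1 → ClassO5 W p → BSDp W p

/-- **Target of class O6** (OPEN PROBLEM; mark OPEN): for every `E/ℚ` of analytic rank `≤ 1` and
every prime `p` with `(E, p) ∈ O6` (then `p = 3`), `BSD(E,3)`. Recorded as a `Prop`. -/
@[conjecture] def O6.Statement : Prop :=
  ∀ (W : WeierstrassCurve ℚ) [W.IsElliptic] [W.IsGloballyMinimal] (p : ℕ) [Fact p.Prime],
    W.analyticRank ≤ 1 → ClassO6 W p → BSDp W p

/-- **Conjecture O5♯** (the class-restricted form of X3♯/X4♯ of `SharpenedStatements.lean` on O5):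
on every O5 pair of analytic rank `≤ 1`, `ord_p #Ш(E) = ord_p #Ш_an(E)` (`Typed.MissingPPartAt`).
CENSUS STATE (EVIDENCE, never a fact): window data of SHARPENED-CONJECTURES v3.2 §3–§4 (X3
`2392 ‖ 1283`, X4 `4906 ‖ 1337` pairs, `N < 2·10⁴ ‖ 10⁴`, `0` inconsistent rows); sweep S-b per-pair
closures on the `p`-unit rows of `O5 ∩ X4 ∩ r = 0 ∩ (12.5.2)` (RESIDUAL-MAP §D D-iv: tame pot-ss
X4@3 `r = 0` tower-surjective on `38 781` of `39 029` pairs, kit jobs j112477/j112912, two engines);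
the lane's E1 experiment X4 legs (a)/(b) (cp-bsd-w4; pre-registered in `CLASS-CLOSURE-PLAN.md`
§3.5) is to attach a held-out-validated leading-term statement here. OPEN; nothing asserted. [folklore] -/
@[conjecture] def O5Sharp : Prop :=
  ∀ (W : WeierstrassCurve ℚ) [W.IsElliptic] [W.IsGloballyMinimal] (p : ℕ) [Fact p.Prime],
    W.analyticRank ≤ 1 → ClassO5 W p → MissingPPartAt W p

/-- **O5♯ on `(G) ∧ ss`** (the `770 @≥5` X4 pairs `+` the `p = 3` share; transport candidate:
§4 and `SubGss.bsdp_iff_overC_of_bsdp_twist`). OPEN; nothing asserted. [folklore] -/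
@[conjecture] def O5SharpGss : Prop :=
  ∀ (W : WeierstrassCurve ℚ) [W.IsElliptic] [W.IsGloballyMinimal] (p : ℕ) [Fact p.Prime],
    W.analyticRank ≤ 1 → p ≠ 2 → Addv W p → SubGss W p → MissingPPartAt W p

/-- **O5♯ on `(t′)`** (`e ∈ {3,4,6}`, `e ∤ p − 1`; at `p = 3` Kodaira III/III*) — the IRREDUCIBLE
residue of O5 (no twist/abelian base change to a semistable situation; Delbourgo p. 152: "the
method presented here cannot cope"). On X3 this is exactly `X3SharpTprime`
(`x3SharpTprime_iff_o5SharpTprime_classX3`). OPEN; nothing asserted. [folklore] -/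
@[conjecture] def O5SharpTprime : Prop :=
  ∀ (W : WeierstrassCurve ℚ) [W.IsElliptic] [W.IsGloballyMinimal] (p : ℕ) [Fact p.Prime],
    W.analyticRank ≤ 1 → p ≠ 2 → Addv W p → SubTprime W p → MissingPPartAt W p

/-- **Conjecture O6♯**: on every O6 pair (wild `p = 3`) of analytic rank `≤ 1`,
`ord₃ #Ш(E) = ord₃ #Ш_an(E)`. On X3 this is `X3SharpW`. CENSUS STATE (EVIDENCE): wild X4@3
`r = 0` tower-surjective on `54 856` of `55 220` S-b pairs (RESIDUAL-MAP §D D-iv), where the upper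
half is the kernel's `X4RankZero.missingUpperBoundAt_of_kato` and the `3`-unit rows close per pair
(`X4RankZero.bsdp_of_shaAn_unit_of_kato`; `388` wild rows among the `866` V20 window closures); E1
experiment X4 third leg (cp-bsd-w4, `754` wild rows `N ≤ 3 000`) pre-registered in
`CLASS-CLOSURE-PLAN.md` §3.4. OPEN; nothing asserted. [folklore] -/
@[conjecture] def O6Sharp : Prop :=
  ∀ (W : WeierstrassCurve ℚ) [W.IsElliptic] [W.IsGloballyMinimal] (p : ℕ) [Fact p.Prime],
    W.analyticRank ≤ 1 → ClassO6 W p → MissingPPartAt W p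

/-- **The uniform rank-`0` LOWER-HALF conjecture at a potentially good additive prime**: for `E/ℚ`
of analytic rank `0` and every ODD additive prime `p` with `ord_p j(E) ≥ 0` — cells (G-ord),
`(G) ∧ ss`, (t′), (w) alike — `ord_p #Ш_an(E) ≤ ord_p #Ш(E)` (`Typed.MissingLowerBoundAt`). IN
PRINT AS A CONJECTURE (module docstring §2): it is the `T = 0`, rank-`0` shadow of Kato's Main
Conjecture 12.10 for `(f_E, p)` (Astérisque 295 p. 224, no reduction hypothesis) — equivalently of
the Bloch–Kato Tamagawa-number equality `#H²(ℤ[1/p], T) = [H¹(ℤ[1/p], T) : z]` "predicted" at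
Kato's Thm. 14.5 (3) (p. 237) — whose `≤` half is Kato's theorem under (12.5.2) and the kernel's
`X4RankZero.missingUpperBoundAt_of_kato`; on (G-ord) it is N10's `MissingLowerBoundAt` (Delbourgo's
Main Conjecture p. 151 at `T = 0`); on `(G) ∧ ss` it is the `η = ω^{(p−1)/2}` branch of
Kobayashi's even/odd main conjecture for the good supersingular twist (Invent. Math. 152 §4).
Nobody announces the converse inequality at an additive prime. EVIDENCE (never a fact): every
`p ∣ #Ш_an` row certified by descent in the cell's records (Cassels–Tate squeeze files
`X4RankZero.bsdp_of_kato_of_casselsTate_of_pow_dvd`, 15 window rows with `#Ш_an = 9` at `p = 3`,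
REQUESTS R14 (a)) is an instance. OPEN; nothing asserted.
[cite: Kato2004Asterisque, Conj. 12.10 (p. 224) and Thm. 14.5 (3) remark (p. 237)] -/
@[conjecture] def PotGoodLowerHalfRankZero : Prop :=
  ∀ (W : WeierstrassCurve ℚ) [W.IsElliptic] [W.IsGloballyMinimal] (p : ℕ) [Fact p.Prime],
    W.analyticRank = 0 → p ≠ 2 → Addv W p → 0 ≤ padicValRat p W.j → MissingLowerBoundAt W p

/-- **O5♯ is exactly the conjunction of its two cells** (`(G) ∧ ss`, (t′)): no pair lost, none
counted twice. [folklore] -/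
theorem o5Sharp_iff : O5Sharp ↔ O5SharpGss ∧ O5SharpTprime := by
  constructor
  · intro h
    exact ⟨fun W _ _ p _ hr hp2 hadd hG ↦ h W p hr ⟨hp2, hadd, Or.inl hG⟩,
      fun W _ _ p _ hr hp2 hadd hT ↦ h W p hr ⟨hp2, hadd, Or.inr hT⟩⟩
  · rintro ⟨hG, hT⟩ W _ _ p _ hr ⟨hp2, hadd, hS⟩
    rcases hS with h | h
    · exact hG W p hr hp2 hadd h
    · exact hT W p hr hp2 hadd h

/-- **On X3, O5♯(t′) is the hyp seat's X3♯(t′)** and conversely X3♯(t′) is the X3 part of O5♯(t′):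
`X3SharpTprime ↔ (O5♯(t′) restricted to X3)`. [folklore] -/
theorem x3SharpTprime_iff_o5SharpTprime_classX3 :
    X3SharpTprime ↔
      ∀ (W : WeierstrassCurve ℚ) [W.IsElliptic] [W.IsGloballyMinimal] (p : ℕ) [Fact p.Prime],
        W.analyticRank ≤ 1 → p ≠ 2 → ClassX3 W p → SubTprime W p → MissingPPartAt W p :=
  Iff.rfl

/-- O5♯(t′) implies X3♯(t′) (its X3 part). [folklore] -/
theorem x3SharpTprime_of_o5SharpTprime (h : O5SharpTprime) : X3SharpTprime :=
  fun W _ _ p _ hr hp2 hX hT ↦ h W p hr hp2 hX.2 hT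

/-- O6♯ implies X3♯(w) (its X3 part). [folklore] -/
theorem x3SharpW_of_o6Sharp (h : O6Sharp) : X3SharpW :=
  fun W _ _ p _ hr hp2 hX hW ↦ h W p hr ⟨hp2, hX.2, hW⟩

/-- **O6♯ is exactly the conjunction of its cyclic and dicyclic Kraus parts** (`WildThreeKrausCells.lean`:
`SubWCyclic` = inertia `C₃/C₆`, `SubWDicyclic` = `C₃ ⋊ C₄`; `ClassO6 W p` forces `p = 3`): no wild pair is
lost and none counted twice. [cite: Kraus1990, Théorème (p = 3)] [cite: Coppola2020, Thm. 2.7] -/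
theorem o6Sharp_iff_cyclic_dicyclic : O6Sharp ↔ O6SharpCyclic ∧ O6SharpDicyclic := by
  rw [← o6SharpW_iff]
  constructor
  · intro h W _ _ hr hadd hW
    exact h W 3 hr ⟨by decide, hadd, hW⟩
  · intro h W _ _ p _ hr hO
    obtain rfl := hO.p_eq_three
    exact h W hr hO.2.1 hO.2.2

/-- X4♯ implies the X4 parts of O5♯ and O6♯ (X4♯ is the whole class X4). [folklore] -/
theorem o5Sharp_o6Sharp_classX4_of_x4Sharp (h : X4Sharp) :
    (∀ (W : WeierstrassCurve ℚ) [W.IsElliptic] [W.IsGloballyMinimal] (p : ℕ) [Fact p.Prime],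
        W.analyticRank ≤ 1 → ClassX4 W p → ClassO5 W p → MissingPPartAt W p) ∧
    (∀ (W : WeierstrassCurve ℚ) [W.IsElliptic] [W.IsGloballyMinimal] (p : ℕ) [Fact p.Prime],
        W.analyticRank ≤ 1 → ClassX4 W p → ClassO6 W p → MissingPPartAt W p) :=
  ⟨fun W _ _ p _ hr hX _ ↦ h W p hr hX, fun W _ _ p _ hr hX _ ↦ h W p hr hX⟩

/-- **X3♯ ∧ X4♯ ⇒ O5♯ ∧ O6♯** (O5, O6 are sub-loci of `X3 ∪ X4` at odd `p`). [folklore] -/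
theorem o5Sharp_and_o6Sharp_of_x3Sharp_of_x4Sharp (h3 : X3Sharp) (h4 : X4Sharp) :
    O5Sharp ∧ O6Sharp := by
  refine ⟨fun W _ _ p _ hr hO ↦ ?_, fun W _ _ p _ hr hO ↦ ?_⟩
  · rcases (classX3_or_classX4_iff_addv W p hO.1).mpr hO.2.1 with hX | hX
    · exact h3 W p hr hO.1 hX
    · exact h4 W p hr hX
  · rcases (classX3_or_classX4_iff_addv W p hO.1).mpr hO.2.1 with hX | hX
    · exact h3 W p hr hO.1 hX
    · exact h4 W p hr hX

/-! ## §3 What the conjectures buy, and what is provable now -/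

section Consequences

variable (W : WeierstrassCurve ℚ) [W.IsElliptic] [W.IsGloballyMinimal] (p : ℕ) [hp : Fact p.Prime]

/-- **O5♯ ⇒ `BSD(E,p)` on class O5 (`r_an ≤ 1`)**, granted Gross–Zagier–Kolyvagin (`hGZK`).
[cite: Miller2011LMS, §1 and Def. 1.1] -/
theorem bsdp_of_o5Sharp (h : O5Sharp) (hGZK : rank_eq_analyticRank_of_analyticRank_le_one)
    (hr : W.analyticRank ≤ 1) (hO : ClassO5 W p) : BSDp W p :=
  bsdp_of_missingPPartAt W p hGZK hr (h W p hr hO)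

/-- **O6♯ ⇒ `BSD(E,3)` on class O6 (`r_an ≤ 1`)**, granted Gross–Zagier–Kolyvagin.
[cite: Miller2011LMS, §1 and Def. 1.1] -/
theorem bsdp_of_o6Sharp (h : O6Sharp) (hGZK : rank_eq_analyticRank_of_analyticRank_le_one)
    (hr : W.analyticRank ≤ 1) (hO : ClassO6 W p) : BSDp W p :=
  bsdp_of_missingPPartAt W p hGZK hr (h W p hr hO)

/-- O5♯ closes the O5 target (and GZK). Bookkeeping: the shape a future theorem must have. [folklore] -/
theorem O5.statement_of_o5Sharp (h : O5Sharp) (hGZK : rank_eq_analyticRank_of_analyticRank_le_one) :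
    O5.Statement := fun W _ _ p _ hr hO ↦ bsdp_of_o5Sharp W p h hGZK hr hO

/-- O6♯ closes the O6 target (and GZK). [folklore] -/
theorem O6.statement_of_o6Sharp (h : O6Sharp) (hGZK : rank_eq_analyticRank_of_analyticRank_le_one) :
    O6.Statement := fun W _ _ p _ hr hO ↦ bsdp_of_o6Sharp W p h hGZK hr hO

/-- **On `O5 ∩ X4 ∩ r = 0 ∩ (12.5.2)` the typed missing input IS its LOWER half** — the upper half
`ord_p #Ш ≤ ord_p #Ш_an` is the kernel theorem `X4RankZero.missingUpperBoundAt_of_kato` (Kato 2004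
Thm. 14.5 (3) + Prop. 14.16 (2), named fact `hKato`; GZK; modularity), valid at every odd
potentially good additive prime, ordinarity-free and twist-free. Hypotheses per pair: tower
surjectivity `∀ n, ρ̄_{E,p^n}` onto (= (12.5.2); `⟸ Surj W p` at `p ≥ 5`, Serre; at `p = 3` decided
on `100 %` of the S-b residue by the tower census), `p ∤ ∏ c_ℓ`, a parametrisation datum `D` with
`p ∤ c_D`. [cite: Kato2004Asterisque, Thm. 14.5 (3) (p. 236), (12.5.2) (p. 222)] [cite: Miller2011LMS, Def. 1.1] -/
theorem ClassO5.missingPPartAt_iff_lower_of_kato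
    (hKato : Kato2004.rankZero_padicValNat_sha_le_of_additive_potGood_of_imageContainsSL2)
    (hGZK : rank_eq_analyticRank_of_analyticRank_le_one) (hmod : hasEntireLFunction_rat)
    (hr : W.analyticRank = 0) (hO : ClassO5 W p) (hX : ClassX4 W p)
    (hsurj : ∀ n : ℕ, W.HasSurjectiveModNGaloisRep (p ^ n : ℕ)) (htam : ¬ p ∣ W.tamagawaProduct)
    {N : ℕ} [NeZero N] (D : ModularParametrizationData W N) (hc : ¬ (p : ℤ) ∣ D.maninConstant) :
    MissingPPartAt W p ↔ MissingLowerBoundAt W p :=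
  X4RankZero.missingPPartAt_iff_lower_of_kato W p hKato hGZK hmod hr hX hO.padicValRat_j_nonneg hsurj
    htam D hc

/-- **On `O6 ∩ X4 ∩ r = 0 ∩ (12.5.2)` the typed missing input IS its LOWER half** (wild `3`
included in Kato's "potentially of good reduction"; line V20 of additive-p4).
[cite: Kato2004Asterisque, Thm. 14.5 (3) (p. 236), (12.5.2) (p. 222)] [cite: Miller2011LMS, Def. 1.1] -/
theorem ClassO6.missingPPartAt_iff_lower_of_kato
    (hKato : Kato2004.rankZero_padicValNat_sha_le_of_additive_potGood_of_imageContainsSL2)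
    (hGZK : rank_eq_analyticRank_of_analyticRank_le_one) (hmod : hasEntireLFunction_rat)
    (hr : W.analyticRank = 0) (hO : ClassO6 W p) (hX : ClassX4 W p)
    (hsurj : ∀ n : ℕ, W.HasSurjectiveModNGaloisRep (p ^ n : ℕ)) (htam : ¬ p ∣ W.tamagawaProduct)
    {N : ℕ} [NeZero N] (D : ModularParametrizationData W N) (hc : ¬ (p : ℤ) ∣ D.maninConstant) :
    MissingPPartAt W p ↔ MissingLowerBoundAt W p :=
  X4RankZero.missingPPartAt_iff_lower_of_kato W p hKato hGZK hmod hr hX hO.padicValRat_j_nonneg hsurj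
    htam D hc

/-- **The uniform lower-half conjecture closes `O5 ∩ X4` and `O6 ∩ X4` in rank `0` on the (12.5.2)
rows** (with `p ∤ ∏ c_ℓ · c_D`): `PotGoodLowerHalfRankZero` + Kato's upper half ⇒ `BSD(E,p)`.
This is the "verbatim-extension" shape handed to provers: ONE inequality at an additive prime.
[cite: Kato2004Asterisque, Thm. 14.5 (3) (p. 236)] [cite: Miller2011LMS, §1 and Def. 1.1] -/
theorem bsdp_rankZero_of_potGoodLowerHalf_of_kato (hlow : PotGoodLowerHalfRankZero)
    (hKato : Kato2004.rankZero_padicValNat_sha_le_of_additive_potGood_of_imageContainsSL2)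
    (hGZK : rank_eq_analyticRank_of_analyticRank_le_one) (hmod : hasEntireLFunction_rat)
    (hr : W.analyticRank = 0) (hO : ClassO5 W p ∨ ClassO6 W p) (hX : ClassX4 W p)
    (hsurj : ∀ n : ℕ, W.HasSurjectiveModNGaloisRep (p ^ n : ℕ)) (htam : ¬ p ∣ W.tamagawaProduct)
    {N : ℕ} [NeZero N] (D : ModularParametrizationData W N) (hc : ¬ (p : ℤ) ∣ D.maninConstant) :
    BSDp W p := by
  have hj : 0 ≤ padicValRat p W.j := by
    rcases hO with h | h
    · exact h.padicValRat_j_nonneg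
    · exact h.padicValRat_j_nonneg
  exact X4RankZero.bsdp_of_missingLowerBoundAt_of_kato W p hKato hGZK hmod hr hX hj hsurj htam D hc
    (hlow W p hr hX.1 hX.2.1 hj)

end Consequences

/-! ## §4 Transport: quadratic base change to `K = ℚ(√p*)` on the cell `(G) ∧ ss` -/

section Transport

variable (W : WeierstrassCurve ℚ) [W.IsElliptic] [W.IsGloballyMinimal] (p : ℕ) [Fact p.Prime]
  (K : Type) [Field K] [NumberField K]
  (Wd : WeierstrassCurve ℚ) [Wd.IsElliptic] [Wd.IsGloballyMinimal]

/-- **TRANSPORT LEMMA T-twist for `(G) ∧ ss` (comparison statement, any `p`).** Let `(E, p)` be any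
pair of analytic rank `≤ 1` (intended: `(E, p) ∈ O5`, cell `(G) ∧ ss`, so `E` is Kodaira `I₀*` at
`p`), `K` a quadratic field (intended: `K = ℚ(√p*)`, `d_K = p* = (−1)^{(p−1)/2} p`, the quadratic
subfield of `ℚ(ζ_p)`) and `Wd` a globally minimal model of the twist `E^{(d_K)}` of analytic rank
`≤ 1` (intended: the GOOD SUPERSINGULAR curve `V` with `E = V^{(p*)}`; `a_p(V) = 0` for `p ≥ 5`).
GRANTED `BSD_p(Wd)` — i.e. `V`'s OWN cell is closed: `r(V) = 1 ∧ V` semistable `∧ (p ≥ 5 ∨ a₃ = 0)`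
is row C3 (Jetchev–Skinner–Wan 2017 Thm. 1.2.1, COVERED, PUB\* `JSW-ss`); `r(V) = 0 ∧ V` semistable
is the corner X6 (Kobayashi's signed main conjecture; BSTW arXiv:2409.01350, PRE); `V`
non-semistable is X7 (OPEN) — **`BSD_p(E)` is EQUIVALENT to the `p`-part of BSD for `E_K ≅ V_K`
over `K`** in Dokchitser–Dokchitser's model-free currency (`AdditivePotMult.MissingPPartOverCAt
(W.baseChange K) p`). Printed antecedent: Milne 1972 §1 Thm. 1 (BSD ⟺ BSD of the Weil
restriction; `Res_{K/ℚ} E_K ~ E × E^{(d_K)}`; Cassels–Tate isogeny invariance), here the tree's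
named fact `hMilneC` and additive-p1's model-free descent `missingPPartOverCAt_baseChange_iff_bsdp`.
What the over-`K` side needs in print: the `η ∈ {1, ω^{(p−1)/2}}`-isotypic part of Kobayashi's
`X^±(V/ℚ(μ_{p^∞}))` and `L_p^±(V, η, X)` (Invent. Math. 152 §4: main conjecture stated for every
`η`; Thm. 4.1 the Kato inclusion) with control down to `K` (`p` RAMIFIED in `K`: B. D. Kim 2013 needs
`p` unramified; Kitajima–Otsuki 2018 over `ℚ(μ_p)`); at `p = 3`, `K = ℚ(ζ₃)`, ranks `(0,0)` the UPPER
half of exactly this is the kernel theorem `XGssRankZeroCyclotomicThree.exists_padicVal_shaOrder_add_le`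
(additive-p4 line V18). [cite: Milne1972ArithmeticAV, §1 Thm. 1] [cite: Kobayashi2003, §4 (p. 8) and Thm. 4.1]
[cite: Miller2011LMS, §1 and Def. 1.1] -/
theorem SubGss.bsdp_iff_overC_of_bsdp_twist
    (hGZK : rank_eq_analyticRank_of_analyticRank_le_one) (hmod : hasEntireLFunction_rat)
    (hMilneC : Milne1972.bsdQuotient_baseChange_quadratic_anyModel)
    (hr : W.analyticRank ≤ 1) (h2 : Module.finrank ℚ K = 2)
    (hWd : ∃ C : VariableChange ℚ, C • W.quadraticTwist (NumberField.discr K : ℚ) = Wd)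
    (hrd : Wd.analyticRank ≤ 1) (hd : BSDp Wd p) :
    BSDp W p ↔ AdditivePotMult.MissingPPartOverCAt (W.baseChange K) p :=
  (AdditivePotMult.missingPPartOverCAt_baseChange_iff_bsdp W p K Wd hGZK hmod hMilneC hr h2 hWd hrd
    hd).symm

/-- **The LOWER half transports too** (the half that is missing on `(G) ∧ ss ∩ X4 ∩ r = 0 ∩
(12.5.2)`): granted `BSD_p(Wd)` and finiteness, `MissingLowerBoundAt W p ↔
MissingLowerBoundOverCAt (W.baseChange K) p` — so the prover's target on this cell is ONE
inequality for the good supersingular curve `V` over the quadratic field `K = ℚ(√p*)`.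
[cite: Milne1972ArithmeticAV, §1 Thm. 1] [cite: Miller2011LMS, Def. 1.1] -/
theorem SubGss.missingLowerBoundAt_iff_overC_of_bsdp_twist
    (hGZK : rank_eq_analyticRank_of_analyticRank_le_one)
    (hmod : hasEntireLFunction_rat) (hMilneC : Milne1972.bsdQuotient_baseChange_quadratic_anyModel)
    (hr : W.analyticRank ≤ 1) (h2 : Module.finrank ℚ K = 2)
    (hWd : ∃ C : VariableChange ℚ, C • W.quadraticTwist (NumberField.discr K : ℚ) = Wd)
    (hrd : Wd.analyticRank ≤ 1) (hd : BSDp Wd p) :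
    MissingLowerBoundAt W p ↔ AdditivePotMult.MissingLowerBoundOverCAt (W.baseChange K) p := by
  haveI : (W.baseChange K).IsElliptic := by rw [baseChange]; infer_instance
  have hV : ∃ C : VariableChange K, C • W.baseChange K = W.baseChange K := ⟨1, one_smul _ _⟩
  obtain ⟨-, hfinW⟩ := hGZK W hr
  obtain ⟨-, hfinD⟩ := hGZK Wd hrd
  obtain ⟨hshaK, hWR⟩ := hMilneC W K h2 Wd hWd (W.baseChange K) hV hfinW hfinD
  exact AdditivePotMult.missingLowerBoundAt_iff_overC W p K Wd (W.baseChange K) hmod h2 hWd hV hfinW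
    hfinD hshaK hWR hd

end Transport


end Summit.BirchSwinnertonDyer.Rank1Residual.Additive

end
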